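import Summits.BirchSwinnertonDyer.BirchSwinnertonDyer.Theorems.AdditiveKolyvaginRoadLowerHalfDescentOfKato
import Literature.NumberTheory.EllipticCurves.ModularSymbols
import Literature.NumberTheory.EllipticCurves.BSDInvariants
import HarnessLib

/-!
# Route `AdditiveKolyvaginRoad`, crux KS′ `LevelKolyvaginSystemsAdditive` (item stmt-BirchSwinnertonDyer-21396): `BSD_p` ON THE ADDITIVE
# POTENTIALLY GOOD ANALYTIC-RANK-0 ROWS FROM THE KURIHARA ROAD (LOWER) + KATO (UPPER) — the class-level reading of crux card
# `kurihara-lower-half` (cell `pub/bsd-wall`, width seat `bsd-wall-akr-p2x-w4` g6; `--supports stmt-BirchSwinnertonDyer-21396`, helper)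

THEOREMS ONLY (no definition, no named fact, no `sorry`).  BSD is not proved by any of this: Kato's Thm. 14.5 (`hKato`), Kim–Nakamura's
criterion (`hKN`), Gross–Zagier–Kolyvagin (`hGZK`), modularity (`hmod`) and the unit Kurihara number (`Kur`, via `hC` or directly) are
DISPLAYED HYPOTHESES; nothing is booked on any W-ALL row.

THE POINT.  On an additive POTENTIALLY GOOD prime `p ≥ 5` of analytic rank `0` with `ρ̄_{E,p}` onto, the tree already has the UPPER
(Euler-system) half of `BSD_p` from Kato (`QuadraticDescent.missingUpperBoundAt_of_kato_of_surj_of_five_le`, w3 g11, over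
`X4RankZero.missingUpperBoundAt_of_kato`).  The crux card `kurihara-lower-half` supplies the LOWER half on the same rows from a unit
Kurihara number (Kim–Nakamura Thm 1.7, typed in the sketch as `KimNakamuraToLowerHalf`; my door file
`…LowerHalfTwistOfKuriharaRoad.lean` abstracts its Kurihara clause to a predicate `Kur`).  The two halves make `BSD_p` (Miller currency,
`Typed.missingPPartAt_of_lower_of_upper`, `Typed.bsdp_of_missingPPartAt`).  So:

* `bsdp_addv_potGood_rankZero_of_kuriharaRoad` — `W/ℚ` globally minimal, `7 < p`, `Addv W p` with `0 ≤ ord_p j` (potentially good),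
  `ρ̄` onto, `p ∤ ∏ c_ℓ`, `p ∤ (ℓ−1)(ℓ+1)` at the multiplicative `ℓ`, `r_an = 0`, a parametrisation `Dt` with `p ∤ c(Dt)` and a rational
  plus-symbol table `ms`, the Kurihara clause `Kur W Dt ms`; Kim–Nakamura-shaped `hKN`; Kato `hKato`; GZK; modularity ⟹ `BSDp W p`.
* `bsdp_addv_potGood_rankZero_of_kuriharaSupply` — the same with `Kur` supplied by the C⁺-shaped hypothesis `hC` (the card's residual
  `KuriharaNonvanishingRankZeroAdditive` at `p`; its non-CM binder is kept displayed as `hCM` — at a ♯ frame it follows from a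
  multiplicative prime, and for `ρ̄` onto at `p ≥ 5` it is Serre's open-image remark, neither of which this row-level statement assumes).

For the W-ALL bookkeeping: the additive potentially-good rank-0 rows with big image and `p > 7` are `BSD_p`-closed MODULO
{Kato 14.5, Kim–Nakamura 1.7, Kurihara non-vanishing (decidable per row), GZK, modularity, Manin}.  HONEST: conditional on every binder.
References (locators only): [cite: KimNakamura2020, Thm 1.7, Rem. 1.8] [cite: Kato2004Asterisque, Thm. 14.5 (3), Prop. 14.16 (2)]
[cite: Miller2011LMS, Def. 1.1].
-/

-- single-conjunct summit: `Summit.BirchSwinnertonDyer.BirchSwinnertonDyer.…` repeats the name by design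
set_option linter.dupNamespace false
set_option autoImplicit false

noncomputable section

open scoped Classical

namespace Summit.BirchSwinnertonDyer.BirchSwinnertonDyer.Theorems.AdditiveKoly.KuriharaRoad

open WeierstrassCurve NumberField
  Literature.NumberTheory.EllipticCurves Literature.NumberTheory.EllipticCurves.ModularForms
  Literature.NumberTheory.EllipticCurves.Rank1Residual Literature.NumberTheory.EllipticCurves.Rank1Residual.Typed

variable (p : ℕ) [hp : Fact p.Prime]

/-- **`BSD_p` AT AN ADDITIVE POTENTIALLY GOOD ANALYTIC-RANK-0 ROW FROM THE KURIHARA ROAD AND KATO.**  Hypotheses (all displayed): the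
Kim–Nakamura-shaped implication `hKN` at `p` (Kurihara clause abstracted to `Kur`); Kato's Thm. 14.5 (3) named fact `hKato`; GZK `hGZK`;
modularity `hmod`; the row: `W` globally minimal, `7 < p`, `Addv W p`, `0 ≤ ord_p j(W)`, `ρ̄_{W,p}` onto, `p ∤ ∏ c_ℓ`, `p ∤ (ℓ−1)(ℓ+1)` at
every multiplicative `ℓ`, `r_an(W) = 0`, a parametrisation `Dt` (level `N_W`) with `p ∤ c(Dt)`, a rational plus-symbol table `ms`, and
the Kurihara clause `Kur W Dt ms`.  Conclusion: `BSDp W p` (Miller).  LOWER half = `hKN`, UPPER half = Kato (w3 g11's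
`missingUpperBoundAt_of_kato_of_surj_of_five_le`), glued by `Typed.missingPPartAt_of_lower_of_upper` + `Typed.bsdp_of_missingPPartAt`.
[cite: KimNakamura2020, Thm 1.7] [cite: Kato2004Asterisque, Thm. 14.5 (3), Prop. 14.16 (2)] [cite: Miller2011LMS, Def. 1.1] -/
theorem bsdp_addv_potGood_rankZero_of_kuriharaRoad
    (Kur : ∀ (X : WeierstrassCurve ℚ) [NeZero (X.conductorNorm ℤ)],
      ModularParametrizationData X (X.conductorNorm ℤ) → (ℚ → ℚ) → Prop)
    (hKN : ∀ (X : WeierstrassCurve ℚ) [X.IsElliptic] [X.IsGloballyMinimal] [NeZero (X.conductorNorm ℤ)]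
      (Dt : ModularParametrizationData X (X.conductorNorm ℤ)) (ms : ℚ → ℚ),
      7 < p → Addv X p → X.HasSurjectiveModNGaloisRep p → ¬ p ∣ X.tamagawaProduct →
      (∀ (ℓ : ℕ) [Fact ℓ.Prime], X.HasMultiplicativeReductionAtPrime ℓ → ¬ p ∣ (ℓ - 1) * (ℓ + 1)) →
      ¬ (p : ℤ) ∣ Dt.c → X.analyticRank = 0 →
      (∀ r : ℚ, (modularSymbol Dt.f r).re = (ms r : ℝ) * X.realPeriodRat) →
      Kur X Dt ms → MissingLowerBoundAt X p)
    (hKato : Kato2004.rankZero_padicValNat_sha_le_of_additive_potGood_of_imageContainsSL2)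
    (hGZK : rank_eq_analyticRank_of_analyticRank_le_one) (hmod : hasEntireLFunction_rat)
    (W : WeierstrassCurve ℚ) [W.IsElliptic] [W.IsGloballyMinimal] [NeZero (W.conductorNorm ℤ)]
    (h7 : 7 < p) (hadd : Addv W p) (hpot : 0 ≤ padicValRat p W.j) (hs : W.HasSurjectiveModNGaloisRep p)
    (htam : ¬ p ∣ W.tamagawaProduct)
    (hmult : ∀ (ℓ : ℕ) [Fact ℓ.Prime], W.HasMultiplicativeReductionAtPrime ℓ → ¬ p ∣ (ℓ - 1) * (ℓ + 1))
    (hr : W.analyticRank = 0)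
    (Dt : ModularParametrizationData W (W.conductorNorm ℤ)) (hc : ¬ (p : ℤ) ∣ Dt.c) (ms : ℚ → ℚ)
    (hms : ∀ r : ℚ, (modularSymbol Dt.f r).re = (ms r : ℝ) * W.realPeriodRat) (hKur : Kur W Dt ms) :
    BSDp W p := by
  have hp5 : 5 ≤ p := by omega
  have hlow : MissingLowerBoundAt W p := hKN W Dt ms h7 hadd hs htam hmult hc hr hms hKur
  have hup : MissingUpperBoundAt W p :=
    QuadraticDescent.missingUpperBoundAt_of_kato_of_surj_of_five_le W p hKato hGZK hmod hp5 hadd hpot hs htam hr Dt hc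
  exact bsdp_of_missingPPartAt W p hGZK (by rw [hr]; exact zero_le_one) (missingPPartAt_of_lower_of_upper W p hlow hup)

/-- **The same with the Kurihara clause supplied by the C⁺-shaped hypothesis** `hC` (the card's residual
`KuriharaNonvanishingRankZeroAdditive` at `p`, Kurihara clause abstracted to `Kur`): on a NON-CM additive potentially good analytic-rank-0
row with `ρ̄` onto and `p > 7` (plus the Kim–Nakamura side binders), `BSDp W p` — modulo `hKN`, `hC`, `hKato`, `hGZK`, `hmod`.
[cite: KimNakamura2020, Thm 1.7, Rem. 1.8] [cite: Kato2004Asterisque, Thm. 14.5 (3)] [cite: Miller2011LMS, Def. 1.1] -/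
theorem bsdp_addv_potGood_rankZero_of_kuriharaSupply
    (Kur : ∀ (X : WeierstrassCurve ℚ) [NeZero (X.conductorNorm ℤ)],
      ModularParametrizationData X (X.conductorNorm ℤ) → (ℚ → ℚ) → Prop)
    (hKN : ∀ (X : WeierstrassCurve ℚ) [X.IsElliptic] [X.IsGloballyMinimal] [NeZero (X.conductorNorm ℤ)]
      (Dt : ModularParametrizationData X (X.conductorNorm ℤ)) (ms : ℚ → ℚ),
      7 < p → Addv X p → X.HasSurjectiveModNGaloisRep p → ¬ p ∣ X.tamagawaProduct →
      (∀ (ℓ : ℕ) [Fact ℓ.Prime], X.HasMultiplicativeReductionAtPrime ℓ → ¬ p ∣ (ℓ - 1) * (ℓ + 1)) →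
      ¬ (p : ℤ) ∣ Dt.c → X.analyticRank = 0 →
      (∀ r : ℚ, (modularSymbol Dt.f r).re = (ms r : ℝ) * X.realPeriodRat) →
      Kur X Dt ms → MissingLowerBoundAt X p)
    (hC : ∀ (X : WeierstrassCurve ℚ) [X.IsElliptic] [X.IsGloballyMinimal] [NeZero (X.conductorNorm ℤ)]
      (Dt : ModularParametrizationData X (X.conductorNorm ℤ)) (ms : ℚ → ℚ),
      5 ≤ p → ¬ X.HasCM → Addv X p → X.HasSurjectiveModNGaloisRep p → X.analyticRank = 0 →
      (∀ r : ℚ, (modularSymbol Dt.f r).re = (ms r : ℝ) * X.realPeriodRat) → Kur X Dt ms)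
    (hKato : Kato2004.rankZero_padicValNat_sha_le_of_additive_potGood_of_imageContainsSL2)
    (hGZK : rank_eq_analyticRank_of_analyticRank_le_one) (hmod : hasEntireLFunction_rat)
    (W : WeierstrassCurve ℚ) [W.IsElliptic] [W.IsGloballyMinimal] [NeZero (W.conductorNorm ℤ)]
    (h7 : 7 < p) (hCM : ¬ W.HasCM) (hadd : Addv W p) (hpot : 0 ≤ padicValRat p W.j) (hs : W.HasSurjectiveModNGaloisRep p)
    (htam : ¬ p ∣ W.tamagawaProduct)
    (hmult : ∀ (ℓ : ℕ) [Fact ℓ.Prime], W.HasMultiplicativeReductionAtPrime ℓ → ¬ p ∣ (ℓ - 1) * (ℓ + 1))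
    (hr : W.analyticRank = 0)
    (Dt : ModularParametrizationData W (W.conductorNorm ℤ)) (hc : ¬ (p : ℤ) ∣ Dt.c) (ms : ℚ → ℚ)
    (hms : ∀ r : ℚ, (modularSymbol Dt.f r).re = (ms r : ℝ) * W.realPeriodRat) :
    BSDp W p :=
  bsdp_addv_potGood_rankZero_of_kuriharaRoad p Kur hKN hKato hGZK hmod W h7 hadd hpot hs htam hmult hr Dt hc ms hms
    (hC W Dt ms (by omega) hCM hadd hs hr hms)

end Summit.BirchSwinnertonDyer.BirchSwinnertonDyer.Theorems.AdditiveKoly.KuriharaRoad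

end
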